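/-
Copyright (c) 2026 The H21 project. Released under Apache 2.0 license.
-/
import Mathlib.LinearAlgebra.FiniteDimensional.Basic
import Mathlib.Analysis.Normed.Module.FiniteDimension
import Summits.RiemannHypothesis.RiemannHypothesis.Theorems.PfPersistenceIntruderArrivalRayleigh
import HarnessLib

/-!
# PF-persistence THEORY 3 (gen 8) — the WITNESSES of the driver laws EXIST and are UNIQUE in
# finite dimension; the secular / shadow / arrival laws WITHOUT witness hypotheses
# (publication cell `pub-rhpf`, theory seat 3)

Framing (page 1 of every `pub-rhpf` file): **mechanism/rigidity campaign — nothing here is a claim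
about RH.** Everything in this file is PROVED abstract linear algebra (no new definitions); no
statement about `ζ` or about any control family is made; every empirical sentence in the
docstrings is labelled DATA and refers to
`run/shared/lean/pub/pub-rhpf/pub-rhpf-theory-3/THEORY-INTRUDER.md` §13.

WHY THIS FILE (adjudication precision Q1/Q2 of RULING A296 (4)): every level-3/4 theorem of THEORY 3
(`PfPersistenceIntruderShadow`, `…ShadowMulti`, `…Arrival`, `…ArrivalMulti`, `…ArrivalRayleigh`)
takes the pre-images `z = B⁻¹v` (`hz : B z = v`) and the shadows `y = (B + |ε|)⁻¹v`
(`hy : B y + |ε| y = v`) as HYPOTHESES — "supplied, not constructed; solvability is not proved" —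
and the form bounds `β ≤ B ≤ Λ` likewise.  Here solvability IS proved, in the setting the cell's
windows live in (a finite-dimensional real inner product space):

* §1 (any `B : E →ₗ[ℝ] E`): a COERCIVE map (`β ⟪x,x⟫ ≤ ⟪B x,x⟫`, `β > 0` — the certified DATA
  premise `λ_min(B) ≥ β > 0` of TH3-N2/N3) has trivial kernel (any dimension) and is BIJECTIVE in
  finite dimension, so `B z = v` has exactly one solution, with `β ‖z‖ ≤ ‖v‖`; `B ≥ 0` shifted by
  `ε > 0` is coercive with constant `ε`, so `B y + ε y = v` has exactly one solution for EVERY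
  `ε > 0` (no premise beyond `B ≥ 0`); an upper form bound `⟪B x,x⟫ ≤ Λ⟪x,x⟫`, `Λ = ‖B‖ ≥ 0`,
  always exists in finite dimension (Q2's `hΛ`).
* §2 (a split `S : OffLineSplitN T ι`, `T = B − ∑ᵢ |vᵢ⟩⟨vᵢ|`, `B ≥ 0`): the shadows exist uniquely
  for every intruder (premise-free); under coercivity the witnesses exist and ANY two witness
  families coincide, so the capacitance matrix `(⟪vᵢ, zⱼ⟫) = VᵀB⁻¹V` is an object of the split
  alone; it is symmetric and positive semidefinite (a Gram matrix in the `B`-form).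
* §3: the multi-driver SECULAR LAW (`n₋(T) = #{μ(M) > 1}`, every `k`), the indefiniteness
  criterion, the RESOLVENT SHADOW, the matrix SECULAR SYSTEM and the ARRIVAL LAW (excess identity,
  two-sided bounds, Rayleigh sandwich `β·Ex(c) ≤ |ε| |c|² ≤ ‖B‖·Ex(c)` with the SAME `β` that
  yields the witnesses) — each with NO `hz` / `hy` / `hΛ` hypothesis.
* §4: the same for a single-driver split `S : OffLineSplit T`: `indefinite ↔ 1 < s`,
  `u = ⟪v,u⟫·y`, `|ε|‖y‖² ≤ s − 1 ≤ |ε|‖z‖²`, `β (s − 1) ≤ |ε| ≤ ‖A‖ (s − 1)`, `s = ⟪v, A⁻¹v⟫`.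

What is NOT discharged (it is the DATA premise): coercivity itself (`β > 0`), i.e. that the
remainder is positive definite at the window — certified per window by two engines
(THEORY-INTRUDER §10) and, by `partialRemainder_nonneg_iff` (`PfPersistenceIntruderArrival`),
equivalent given witnesses to 'the unlisted off-line zeros are jointly sub-critical' (RULING A250).
Infinite-dimensional versions (Lax–Milgram) are not needed by the cell and not stated.

Don't-look sentence (RULING A24 k4): every statement here holds for ANY symmetric window admitting
such a split — Davenport–Heilbronn, Epstein, planted controls alike; nothing in this file separates
`ζ` from a control.

## References
* G. H. Golub, C. F. Van Loan, *Matrix Computations*, 4th ed. (2013), Thm 8.4.3. [GolubVanLoan2013]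
* P. Arbenz, G. H. Golub, SIAM J. Matrix Anal. Appl. 9 (1988) 40–58. [ArbenzGolub1988]
* J. R. Bunch, C. P. Nielsen, D. C. Sorensen, Numer. Math. 31 (1978) 31–48. [BunchNielsenSorensen1978]
* E. V. Haynsworth, Linear Algebra Appl. 1 (1968) 73–81. [Haynsworth1968]
-/

open scoped InnerProductSpace BigOperators

set_option linter.dupNamespace false

namespace Summit.RiemannHypothesis.RiemannHypothesis.Theorems.PfPersistenceIntruderWitness

open Literature.Analysis.InnerProduct
open Summit.RiemannHypothesis.RiemannHypothesis.Theorems.PfPersistenceIntruderOrthogonality (Intruder)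
open Summit.RiemannHypothesis.RiemannHypothesis.Theorems.PfPersistenceIntruderShadow (OffLineSplit)
open Summit.RiemannHypothesis.RiemannHypothesis.Theorems.PfPersistenceIntruderShadowMulti (OffLineSplitN)
open Summit.RiemannHypothesis.RiemannHypothesis.Theorems.PfPersistenceIntruderArrival
  (one_lt_secular negEig_two_sided mul_excess_le_negEig negEig_le_mul_excess)
open Summit.RiemannHypothesis.RiemannHypothesis.Theorems.PfPersistenceIntruderArrivalMulti
  (excess_eq negEig_le_excess excess_le_negEig_mul_sq)
open Summit.RiemannHypothesis.RiemannHypothesis.Theorems.PfPersistenceIntruderArrivalRayleigh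
  (mul_excess_le_negEig_mul_sq_moment negEig_mul_sq_moment_le_mul_excess)

variable {E : Type*} [NormedAddCommGroup E] [InnerProductSpace ℝ E]

/-! ## 1. Coercive linear maps: kernel, bijectivity, unique pre-images, bounds -/

section Coercive

variable (B : E →ₗ[ℝ] E) {β : ℝ}

/-- A coercive linear map (`β ⟪x,x⟫ ≤ ⟪B x, x⟫`, `β > 0`) has trivial kernel — in any dimension.
[folklore] -/
theorem ker_eq_bot_of_coercive (hβ : 0 < β) (hco : ∀ x : E, β * ⟪x, x⟫_ℝ ≤ ⟪B x, x⟫_ℝ) :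
    LinearMap.ker B = ⊥ := by
  refine LinearMap.ker_eq_bot'.mpr fun x hx => ?_
  have h := hco x
  rw [hx, inner_zero_left] at h
  have hx0 : ⟪x, x⟫_ℝ ≤ 0 := le_of_mul_le_mul_left (by rwa [mul_zero]) hβ
  exact real_inner_self_nonpos.mp hx0

/-- A coercive linear map is injective — in any dimension. [folklore] -/
theorem injective_of_coercive (hβ : 0 < β) (hco : ∀ x : E, β * ⟪x, x⟫_ℝ ≤ ⟪B x, x⟫_ℝ) :
    Function.Injective B :=
  LinearMap.ker_eq_bot.mp (ker_eq_bot_of_coercive B hβ hco)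

/-- **A coercive linear map on a finite-dimensional space is bijective** (injective endomorphisms of
a finite-dimensional space are surjective). [folklore] -/
theorem bijective_of_coercive [FiniteDimensional ℝ E] (hβ : 0 < β)
    (hco : ∀ x : E, β * ⟪x, x⟫_ℝ ≤ ⟪B x, x⟫_ℝ) : Function.Bijective B :=
  ⟨injective_of_coercive B hβ hco,
    LinearMap.injective_iff_surjective.mp (injective_of_coercive B hβ hco)⟩

/-- **Unique solvability of `B z = v`** for a coercive `B` in finite dimension: the witness
`z = B⁻¹v` of the driver laws EXISTS and is UNIQUE. [folklore] -/
theorem existsUnique_preimage_of_coercive [FiniteDimensional ℝ E] (hβ : 0 < β)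
    (hco : ∀ x : E, β * ⟪x, x⟫_ℝ ≤ ⟪B x, x⟫_ℝ) (v : E) : ∃! z : E, B z = v := by
  obtain ⟨hinj, hsurj⟩ := bijective_of_coercive B hβ hco
  obtain ⟨z, hz⟩ := hsurj v
  exact ⟨z, hz, fun z' hz' => hinj (hz'.trans hz.symm)⟩

/-- A-priori bound on the witness: `β ‖z‖ ≤ ‖v‖` whenever `B z = v` (any dimension, any lower
form bound `β`): `β‖z‖² ≤ ⟪B z, z⟫ = ⟪v, z⟫ ≤ ‖v‖‖z‖`. [folklore] -/
theorem mul_norm_le_norm_of_apply_eq (hco : ∀ x : E, β * ⟪x, x⟫_ℝ ≤ ⟪B x, x⟫_ℝ)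
    {z v : E} (hz : B z = v) : β * ‖z‖ ≤ ‖v‖ := by
  have h1 : β * ⟪z, z⟫_ℝ ≤ ⟪B z, z⟫_ℝ := hco z
  rw [hz, real_inner_self_eq_norm_sq] at h1
  have h2 : ⟪v, z⟫_ℝ ≤ ‖v‖ * ‖z‖ := real_inner_le_norm v z
  by_cases hz0 : ‖z‖ = 0
  · rw [hz0, mul_zero]; exact norm_nonneg v
  · have hzpos : 0 < ‖z‖ := lt_of_le_of_ne (norm_nonneg z) (Ne.symm hz0)
    refine le_of_mul_le_mul_right ?_ hzpos
    calc β * ‖z‖ * ‖z‖ = β * ‖z‖ ^ 2 := by ring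
      _ ≤ ‖v‖ * ‖z‖ := h1.trans h2

/-- A form-nonnegative map shifted by `ε` is coercive with constant `ε`:
`ε ⟪x,x⟫ ≤ ⟪(B + ε·1) x, x⟫` (any dimension, any real `ε`). [folklore] -/
theorem coercive_add_smul_id (hB : ∀ x : E, 0 ≤ ⟪B x, x⟫_ℝ) (ε : ℝ) (x : E) :
    ε * ⟪x, x⟫_ℝ ≤ ⟪(B + ε • (LinearMap.id : E →ₗ[ℝ] E)) x, x⟫_ℝ := by
  simp only [LinearMap.add_apply, LinearMap.smul_apply, LinearMap.id_coe, id_eq, inner_add_left,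
    real_inner_smul_left]
  linarith [hB x]

/-- **Unique solvability of the shifted system `B y + ε y = v`** for `B ≥ 0` and EVERY `ε > 0` in
finite dimension: the resolvent shadow `y = (B + ε)⁻¹v` exists and is unique, with no premise on `B`
beyond form-nonnegativity. [folklore] -/
theorem existsUnique_shifted_preimage [FiniteDimensional ℝ E] (hB : ∀ x : E, 0 ≤ ⟪B x, x⟫_ℝ)
    {ε : ℝ} (hε : 0 < ε) (v : E) : ∃! y : E, B y + ε • y = v := by
  have h := existsUnique_preimage_of_coercive (B + ε • (LinearMap.id : E →ₗ[ℝ] E)) hε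
    (coercive_add_smul_id B hB ε) v
  simpa only [LinearMap.add_apply, LinearMap.smul_apply, LinearMap.id_coe, id_eq] using h

/-- In finite dimension an UPPER form bound always exists: `⟪B x, x⟫ ≤ ‖B‖ ⟪x, x⟫` with
`‖B‖ ≥ 0` the operator norm (precision Q2's hypothesis `hΛ` is dischargeable). [folklore] -/
theorem exists_form_le [FiniteDimensional ℝ E] :
    ∃ Λ : ℝ, 0 ≤ Λ ∧ ∀ x : E, ⟪B x, x⟫_ℝ ≤ Λ * ⟪x, x⟫_ℝ := by
  refine ⟨‖LinearMap.toContinuousLinearMap B‖, norm_nonneg _, fun x => ?_⟩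
  have h1 : ⟪B x, x⟫_ℝ ≤ ‖B x‖ * ‖x‖ := real_inner_le_norm _ _
  have h2 : ‖B x‖ ≤ ‖LinearMap.toContinuousLinearMap B‖ * ‖x‖ := by
    simpa using (LinearMap.toContinuousLinearMap B).le_opNorm x
  calc ⟪B x, x⟫_ℝ ≤ ‖B x‖ * ‖x‖ := h1
    _ ≤ ‖LinearMap.toContinuousLinearMap B‖ * ‖x‖ * ‖x‖ :=
        mul_le_mul_of_nonneg_right h2 (norm_nonneg x)
    _ = ‖LinearMap.toContinuousLinearMap B‖ * ⟪x, x⟫_ℝ := by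
        rw [real_inner_self_eq_norm_sq]; ring

end Coercive

/-! ## 2. Witnesses and shadows of a multi-driver split exist; the capacitance matrix is intrinsic -/

section MultiDriver

variable {ι : Type*} [Fintype ι] {T : E →ₗ[ℝ] E} (S : OffLineSplitN T ι)

/-- **The resolvent shadows exist, uniquely, for every intruder — premise-free**: for each driver
`vᵢ` there is exactly one `yᵢ` with `B yᵢ + |ε| yᵢ = vᵢ` (`B ≥ 0` is part of the split, `|ε| > 0`).
[cite: GolubVanLoan2013, Thm 8.4.3] -/
theorem existsUnique_shadow [FiniteDimensional ℝ E] (I : Intruder T) (i : ι) :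
    ∃! y : E, S.B y + (-I.eig) • y = S.v i :=
  existsUnique_shifted_preimage S.B S.B_nonneg (neg_pos.mpr I.eig_neg) (S.v i)

/-- The shadow family of an intruder exists (premise-free). [cite: GolubVanLoan2013, Thm 8.4.3] -/
theorem exists_shadows [FiniteDimensional ℝ E] (I : Intruder T) :
    ∃ y : ι → E, ∀ i, S.B (y i) + (-I.eig) • y i = S.v i :=
  ⟨fun i => (existsUnique_shadow S I i).exists.choose,
    fun i => (existsUnique_shadow S I i).exists.choose_spec⟩

/-- Under coercivity of the remainder (`β ⟪x,x⟫ ≤ ⟪B x,x⟫`, `β > 0`) each witness equation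
`B zᵢ = vᵢ` has exactly one solution. [cite: ArbenzGolub1988, capacitance matrix] -/
theorem existsUnique_witness [FiniteDimensional ℝ E] {β : ℝ} (hβ : 0 < β)
    (hco : ∀ x : E, β * ⟪x, x⟫_ℝ ≤ ⟪S.B x, x⟫_ℝ) (i : ι) : ∃! z : E, S.B z = S.v i :=
  existsUnique_preimage_of_coercive S.B hβ hco (S.v i)

/-- **The witness family `z = B⁻¹V` exists under coercivity.**
[cite: ArbenzGolub1988, capacitance matrix] -/
theorem exists_witnesses [FiniteDimensional ℝ E] {β : ℝ} (hβ : 0 < β)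
    (hco : ∀ x : E, β * ⟪x, x⟫_ℝ ≤ ⟪S.B x, x⟫_ℝ) : ∃ z : ι → E, ∀ i, S.B (z i) = S.v i :=
  ⟨fun i => (existsUnique_witness S hβ hco i).exists.choose,
    fun i => (existsUnique_witness S hβ hco i).exists.choose_spec⟩

/-- **Two witness families coincide** (coercive `B`, any dimension): the capacitance matrix
`(⟪vᵢ, zⱼ⟫) = VᵀB⁻¹V` does not depend on which solution family is used — what the two engines
compute IS the object of the theorems. [folklore] -/
theorem witnesses_eq {β : ℝ} (hβ : 0 < β) (hco : ∀ x : E, β * ⟪x, x⟫_ℝ ≤ ⟪S.B x, x⟫_ℝ)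
    {z z' : ι → E} (hz : ∀ i, S.B (z i) = S.v i) (hz' : ∀ i, S.B (z' i) = S.v i) : z = z' :=
  funext fun i => injective_of_coercive S.B hβ hco ((hz i).trans (hz' i).symm)

/-- A-priori bound on every witness: `β ‖zᵢ‖ ≤ ‖vᵢ‖`. [folklore] -/
theorem mul_norm_witness_le {β : ℝ} (hco : ∀ x : E, β * ⟪x, x⟫_ℝ ≤ ⟪S.B x, x⟫_ℝ)
    {z : ι → E} (hz : ∀ i, S.B (z i) = S.v i) (i : ι) : β * ‖z i‖ ≤ ‖S.v i‖ :=
  mul_norm_le_norm_of_apply_eq S.B hco (hz i)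

/-- **The capacitance matrix is symmetric**: `⟪vᵢ, zⱼ⟫ = ⟪B zᵢ, zⱼ⟫ = ⟪zᵢ, B zⱼ⟫ = ⟪vⱼ, zᵢ⟫`.
[cite: ArbenzGolub1988, capacitance matrix] -/
theorem inner_driver_witness_comm {z : ι → E} (hz : ∀ i, S.B (z i) = S.v i) (i j : ι) :
    ⟪S.v i, z j⟫_ℝ = ⟪S.v j, z i⟫_ℝ := by
  rw [← hz i, S.B_symm, hz j, real_inner_comm]

/-- The capacitance quadratic form is the `B`-form of the combination of the witnesses:
`∑ᵢ∑ⱼ cᵢcⱼ⟪vᵢ, zⱼ⟫ = ⟪B(∑ cᵢzᵢ), ∑ cⱼzⱼ⟫` (a Gram matrix in the `B`-form). [folklore] -/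
theorem sum_sum_mul_inner_driver_witness_eq {z : ι → E} (hz : ∀ i, S.B (z i) = S.v i) (c : ι → ℝ) :
    ∑ i, ∑ j, c i * c j * ⟪S.v i, z j⟫_ℝ = ⟪S.B (∑ i, c i • z i), ∑ j, c j • z j⟫_ℝ := by
  symm
  rw [map_sum, sum_inner]
  refine Finset.sum_congr rfl fun i _ => ?_
  rw [map_smul, hz i, real_inner_smul_left, inner_sum, Finset.mul_sum]
  refine Finset.sum_congr rfl fun j _ => ?_
  rw [real_inner_smul_right]; ring

/-- **The capacitance matrix is positive semidefinite**: `0 ≤ cᵀMc` for every coefficient vector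
(so its eigenvalues `μₖ` are `≥ 0`; the secular law counts those above `1`).
[cite: ArbenzGolub1988, capacitance matrix] -/
theorem capacitanceForm_nonneg {z : ι → E} (hz : ∀ i, S.B (z i) = S.v i) (c : ι → ℝ) :
    0 ≤ ∑ i, ∑ j, c i * c j * ⟪S.v i, z j⟫_ℝ := by
  rw [sum_sum_mul_inner_driver_witness_eq S hz c]
  exact S.B_nonneg _

/-! ## 3. The multi-driver laws with the witnesses constructed (no `hz` / `hy` / `hΛ` hypotheses) -/

/-- **Multi-driver secular law, hypothesis-free** (finite dimension, coercive remainder): there is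
a witness family `B zᵢ = vᵢ` (unique by `witnesses_eq`), and for it, for EVERY `k`: the window form
is negative definite on some `k`-dimensional subspace iff `I − M`, `M = (⟪vᵢ, zⱼ⟫)`, is negative
definite on some `k`-dimensional subspace of coefficient space — `n₋(T) = #{μ(M) > 1}`.
[cite: Haynsworth1968, inertia additivity formula; ArbenzGolub1988, capacitance matrix] -/
theorem secular_law [FiniteDimensional ℝ E] {β : ℝ} (hβ : 0 < β)
    (hco : ∀ x : E, β * ⟪x, x⟫_ℝ ≤ ⟪S.B x, x⟫_ℝ) :
    ∃ z : ι → E, (∀ i, S.B (z i) = S.v i) ∧ ∀ k : ℕ,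
      ((∃ W : Submodule ℝ E, Module.finrank ℝ W = k ∧ ∀ x ∈ W, x ≠ 0 → ⟪T x, x⟫_ℝ < 0) ↔
        ∃ U : Submodule ℝ (ι → ℝ), Module.finrank ℝ U = k ∧
          ∀ c ∈ U, c ≠ 0 → (∑ i, c i ^ 2 - ∑ i, ∑ j, c i * c j * ⟪S.v i, z j⟫_ℝ) < 0) := by
  obtain ⟨z, hz⟩ := exists_witnesses S hβ hco
  exact ⟨z, hz, fun k => S.negSubspace_iff_capacitance z hz k⟩

/-- **Indefiniteness criterion, hypothesis-free**: with the (existing) witness family, the window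
takes a negative value iff `|c|² < cᵀMc` for some `c` (`λ_max(M) > 1`).
[cite: ArbenzGolub1988, capacitance matrix] -/
theorem indefinite_iff [FiniteDimensional ℝ E] {β : ℝ} (hβ : 0 < β)
    (hco : ∀ x : E, β * ⟪x, x⟫_ℝ ≤ ⟪S.B x, x⟫_ℝ) :
    ∃ z : ι → E, (∀ i, S.B (z i) = S.v i) ∧
      ((∃ x : E, ⟪T x, x⟫_ℝ < 0) ↔
        ∃ c : ι → ℝ, (∑ i, c i ^ 2 - ∑ i, ∑ j, c i * c j * ⟪S.v i, z j⟫_ℝ) < 0) := by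
  obtain ⟨z, hz⟩ := exists_witnesses S hβ hco
  exact ⟨z, hz, S.negative_iff_capacitance_negative z hz⟩

/-- **Resolvent shadow, hypothesis-free and premise-free**: every intruder is a combination of the
(existing, unique) shadows of the drivers, `u = ∑ᵢ ⟪vᵢ,u⟫ yᵢ` with `B yᵢ + |ε| yᵢ = vᵢ`.
[cite: GolubVanLoan2013, Thm 8.4.3 (c); ArbenzGolub1988, block secular equation] -/
theorem intruder_eq_sum_shadow [FiniteDimensional ℝ E] (I : Intruder T) :
    ∃ y : ι → E, (∀ i, S.B (y i) + (-I.eig) • y i = S.v i) ∧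
      I.vec = ∑ i, ⟪S.v i, I.vec⟫_ℝ • y i := by
  obtain ⟨y, hy⟩ := exists_shadows S I
  exact ⟨y, hy, S.intruder_eq_sum_resolvent I y hy⟩

/-- **Matrix secular system, hypothesis-free and premise-free**: the moment vector `c = (⟪vᵢ,u⟫)` of
every intruder is nonzero and is fixed by `M(|ε|) = (⟪vᵢ,yⱼ⟫) = Vᵀ(B + |ε|)⁻¹V` for the (existing)
shadow family — `1 ∈ spec M(|ε|)`.
[cite: GolubVanLoan2013, Thm 8.4.3 (a); ArbenzGolub1988, block secular equation] -/
theorem secular_system [FiniteDimensional ℝ E] (I : Intruder T) :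
    ∃ y : ι → E, (∀ i, S.B (y i) + (-I.eig) • y i = S.v i) ∧
      (fun i => ⟪S.v i, I.vec⟫_ℝ) ≠ 0 ∧
      ∀ i, ⟪S.v i, I.vec⟫_ℝ = ∑ j, ⟪S.v i, y j⟫_ℝ * ⟪S.v j, I.vec⟫_ℝ := by
  obtain ⟨y, hy⟩ := exists_shadows S I
  exact ⟨y, hy, S.secular_system I y hy⟩

/-- **Arrival law, hypothesis-free** (finite dimension, coercive remainder with constant `β`): there
is a witness family `B zⱼ = vⱼ` such that for EVERY intruder `(−|ε|, u)`, with `c = Vᵀu`,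
`Ex(c) = cᵀ(M − I)c` and `Zc = ∑ⱼ cⱼ zⱼ`: the EXCESS IDENTITY `Ex(c) = |ε| ⟪u, Zc⟫`, the two-sided
law `|ε| ≤ Ex(c) ≤ |ε| ‖Zc‖²`, and the coercive Rayleigh bound `β · Ex(c) ≤ |ε| |c|²`
(`λ_min(B)(r − 1) ≤ |ε|`) with the SAME `β` that yields the witnesses.
[cite: GolubVanLoan2013, Thm 8.4.3; ArbenzGolub1988, block secular equation] -/
theorem arrival_law [FiniteDimensional ℝ E] {β : ℝ} (hβ : 0 < β)
    (hco : ∀ x : E, β * ⟪x, x⟫_ℝ ≤ ⟪S.B x, x⟫_ℝ) :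
    ∃ z : ι → E, (∀ i, S.B (z i) = S.v i) ∧ ∀ I : Intruder T,
      (∑ i, ∑ j, ⟪S.v i, I.vec⟫_ℝ * ⟪S.v j, I.vec⟫_ℝ * ⟪S.v i, z j⟫_ℝ
            - ∑ i, ⟪S.v i, I.vec⟫_ℝ ^ 2
          = (-I.eig) * ⟪I.vec, ∑ j, ⟪S.v j, I.vec⟫_ℝ • z j⟫_ℝ) ∧
      (-I.eig ≤ ∑ i, ∑ j, ⟪S.v i, I.vec⟫_ℝ * ⟪S.v j, I.vec⟫_ℝ * ⟪S.v i, z j⟫_ℝ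
            - ∑ i, ⟪S.v i, I.vec⟫_ℝ ^ 2) ∧
      (∑ i, ∑ j, ⟪S.v i, I.vec⟫_ℝ * ⟪S.v j, I.vec⟫_ℝ * ⟪S.v i, z j⟫_ℝ
            - ∑ i, ⟪S.v i, I.vec⟫_ℝ ^ 2
          ≤ (-I.eig) * ⟪∑ j, ⟪S.v j, I.vec⟫_ℝ • z j, ∑ j, ⟪S.v j, I.vec⟫_ℝ • z j⟫_ℝ) ∧
      β * (∑ i, ∑ j, ⟪S.v i, I.vec⟫_ℝ * ⟪S.v j, I.vec⟫_ℝ * ⟪S.v i, z j⟫_ℝ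
            - ∑ i, ⟪S.v i, I.vec⟫_ℝ ^ 2)
          ≤ (-I.eig) * ∑ i, ⟪S.v i, I.vec⟫_ℝ ^ 2 := by
  obtain ⟨z, hz⟩ := exists_witnesses S hβ hco
  exact ⟨z, hz, fun I => ⟨excess_eq S I z hz, negEig_le_excess S I z hz,
    excess_le_negEig_mul_sq S I z hz, mul_excess_le_negEig_mul_sq_moment S I z hz hβ.le hco⟩⟩

/-- **Two-sided Rayleigh arrival law with BOTH scales and the witnesses constructed**: for a
coercive split in finite dimension there are `Λ ≥ 0` (`= ‖B‖`) and a witness family with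
`β · Ex(c) ≤ |ε| |c|² ≤ Λ · Ex(c)` for EVERY intruder — `λ_min(B)(r − 1) ≤ |ε| ≤ ‖B‖(r − 1)` with
no hypothesis left but coercivity. [cite: GolubVanLoan2013, Thm 8.4.3; ArbenzGolub1988, block
secular equation] -/
theorem rayleigh_two_sided [FiniteDimensional ℝ E] {β : ℝ} (hβ : 0 < β)
    (hco : ∀ x : E, β * ⟪x, x⟫_ℝ ≤ ⟪S.B x, x⟫_ℝ) :
    ∃ Λ : ℝ, 0 ≤ Λ ∧ ∃ z : ι → E, (∀ i, S.B (z i) = S.v i) ∧ ∀ I : Intruder T,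
      β * (∑ i, ∑ j, ⟪S.v i, I.vec⟫_ℝ * ⟪S.v j, I.vec⟫_ℝ * ⟪S.v i, z j⟫_ℝ
            - ∑ i, ⟪S.v i, I.vec⟫_ℝ ^ 2)
          ≤ (-I.eig) * ∑ i, ⟪S.v i, I.vec⟫_ℝ ^ 2 ∧
        (-I.eig) * ∑ i, ⟪S.v i, I.vec⟫_ℝ ^ 2
          ≤ Λ * (∑ i, ∑ j, ⟪S.v i, I.vec⟫_ℝ * ⟪S.v j, I.vec⟫_ℝ * ⟪S.v i, z j⟫_ℝ
            - ∑ i, ⟪S.v i, I.vec⟫_ℝ ^ 2) := by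
  obtain ⟨Λ, hΛ0, hΛ⟩ := exists_form_le S.B
  obtain ⟨z, hz⟩ := exists_witnesses S hβ hco
  exact ⟨Λ, hΛ0, z, hz, fun I => ⟨mul_excess_le_negEig_mul_sq_moment S I z hz hβ.le hco,
    negEig_mul_sq_moment_le_mul_excess S I z hz hΛ⟩⟩

end MultiDriver

/-! ## 4. The single-driver split `T = A − |v⟩⟨v|` -/

section SingleDriver

variable {T : E →ₗ[ℝ] E} (S : OffLineSplit T)

/-- The shadow `y = (A + |ε|)⁻¹v` of an intruder exists uniquely, premise-free.
[cite: GolubVanLoan2013, Thm 8.4.3] -/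
theorem existsUnique_shadow₁ [FiniteDimensional ℝ E] (I : Intruder T) :
    ∃! y : E, S.A y + (-I.eig) • y = S.v :=
  existsUnique_shifted_preimage S.A S.A_nonneg (neg_pos.mpr I.eig_neg) S.v

/-- The witness `z = A⁻¹v` exists uniquely under coercivity (so the secular scalar `s = ⟪v, z⟫` is
an object of the split alone). [cite: BunchNielsenSorensen1978] -/
theorem existsUnique_witness₁ [FiniteDimensional ℝ E] {β : ℝ} (hβ : 0 < β)
    (hco : ∀ x : E, β * ⟪x, x⟫_ℝ ≤ ⟪S.A x, x⟫_ℝ) : ∃! z : E, S.A z = S.v :=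
  existsUnique_preimage_of_coercive S.A hβ hco S.v

/-- **Secular criterion, hypothesis-free**: there is a (unique) witness `A z = v`, and the window
takes a negative value iff `1 < s = ⟪v, z⟫`. [cite: BunchNielsenSorensen1978] -/
theorem indefinite_iff_one_lt_secular [FiniteDimensional ℝ E] {β : ℝ} (hβ : 0 < β)
    (hco : ∀ x : E, β * ⟪x, x⟫_ℝ ≤ ⟪S.A x, x⟫_ℝ) :
    ∃ z : E, S.A z = S.v ∧ ((∃ x : E, ⟪T x, x⟫_ℝ < 0) ↔ 1 < ⟪S.v, z⟫_ℝ) := by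
  obtain ⟨z, hz, -⟩ := existsUnique_witness₁ S hβ hco
  exact ⟨z, hz, S.negative_iff_secular_gt_one hz⟩

/-- **Resolvent shadow, hypothesis-free and premise-free** (single driver): `u = ⟪v,u⟫ · y` for the
(existing, unique) shadow `A y + |ε| y = v`, and the secular equation `⟪v, y⟫ = 1` holds.
[cite: GolubVanLoan2013, Thm 8.4.3] -/
theorem intruder_eq_smul_shadow [FiniteDimensional ℝ E] (I : Intruder T) :
    ∃ y : E, S.A y + (-I.eig) • y = S.v ∧ I.vec = ⟪S.v, I.vec⟫_ℝ • y ∧ ⟪S.v, y⟫_ℝ = 1 := by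
  obtain ⟨y, hy, -⟩ := existsUnique_shadow₁ S I
  exact ⟨y, hy, S.intruder_eq_smul_resolvent I hy, S.secular_eq_one I hy⟩

/-- **Arrival law, hypothesis-free** (single driver, coercive remainder with constant `β`): with THE
shadow `y` and THE witness `z` of an intruder `(−|ε|, u)`, `s = ⟪v, z⟫`: `1 < s`,
`|ε| ‖y‖² ≤ s − 1 ≤ |ε| ‖z‖²` and `β (s − 1) ≤ |ε|` (`λ_min(A)(s − 1) ≤ |ε₁|`).
[cite: GolubVanLoan2013, Thm 8.4.3; BunchNielsenSorensen1978] -/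
theorem arrival_law₁ [FiniteDimensional ℝ E] {β : ℝ} (hβ : 0 < β)
    (hco : ∀ x : E, β * ⟪x, x⟫_ℝ ≤ ⟪S.A x, x⟫_ℝ) (I : Intruder T) :
    ∃ y z : E, S.A y + (-I.eig) • y = S.v ∧ S.A z = S.v ∧ 1 < ⟪S.v, z⟫_ℝ ∧
      (-I.eig) * ⟪y, y⟫_ℝ ≤ ⟪S.v, z⟫_ℝ - 1 ∧ ⟪S.v, z⟫_ℝ - 1 ≤ (-I.eig) * ⟪z, z⟫_ℝ ∧
      β * (⟪S.v, z⟫_ℝ - 1) ≤ -I.eig := by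
  obtain ⟨y, hy, -⟩ := existsUnique_shadow₁ S I
  obtain ⟨z, hz, -⟩ := existsUnique_witness₁ S hβ hco
  exact ⟨y, z, hy, hz, one_lt_secular S I hz, (negEig_two_sided S I hy hz).1,
    (negEig_two_sided S I hy hz).2, mul_excess_le_negEig S I hy hz hβ.le hco⟩

/-- **Two-sided Rayleigh arrival law with both scales constructed** (single driver): there are
`Λ ≥ 0` (`= ‖A‖`) and THE witness `z` with `β (s − 1) ≤ |ε| ≤ Λ (s − 1)` for every intruder.
[cite: GolubVanLoan2013, Thm 8.4.3] -/
theorem rayleigh_two_sided₁ [FiniteDimensional ℝ E] {β : ℝ} (hβ : 0 < β)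
    (hco : ∀ x : E, β * ⟪x, x⟫_ℝ ≤ ⟪S.A x, x⟫_ℝ) :
    ∃ Λ : ℝ, 0 ≤ Λ ∧ ∃ z : E, S.A z = S.v ∧ ∀ I : Intruder T,
      β * (⟪S.v, z⟫_ℝ - 1) ≤ -I.eig ∧ -I.eig ≤ Λ * (⟪S.v, z⟫_ℝ - 1) := by
  obtain ⟨Λ, hΛ0, hΛ⟩ := exists_form_le S.A
  obtain ⟨z, hz, -⟩ := existsUnique_witness₁ S hβ hco
  refine ⟨Λ, hΛ0, z, hz, fun I => ⟨?_, negEig_le_mul_excess S I hz hΛ⟩⟩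
  obtain ⟨y, hy, -⟩ := existsUnique_shadow₁ S I
  exact mul_excess_le_negEig S I hy hz hβ.le hco

end SingleDriver

end Summit.RiemannHypothesis.RiemannHypothesis.Theorems.PfPersistenceIntruderWitness
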